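import Literature.Analysis.FluidPDE.DistributionalEulerOfUniformLimit
import Literature.Analysis.FluidPDE.GloballyDissipativeEuler
import HarnessLib

/-!
# Uniform limits of dissipative Euler–Reynolds-type approximations are globally dissipative
# Euler flows (De Lellis–Kwon 2022, §2.2–2.3)

Support file (theorem-only) for the named fact `Torus.DeLellisKwon2022_thm11`
(`GloballyDissipativeEuler`): the analytic half of the passage to the limit in the printed proof
of De Lellis–Kwon, Anal. PDE 15 (2022) = arXiv:2006.06482, Thm. 1.1. In §2.2–2.3 the iteration
(Prop. 2.3) produces dissipative Euler–Reynolds flows `(v_q, p_q, R_q, κ_q, φ_q)` (Def. 2.1) with a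
fixed energy loss `E(t)`, `(v_q, p_q) → (v, p)` uniformly and `(R_q, κ_q, φ_q) → 0` uniformly on
`[0,T] × T³`; "Since `(R_q, κ_q, φ_q)` converges to `0` in `C⁰([0,T] × T³)`, the limit `(v,p)`
solves the Euler equation and satisfies" the local energy balance
`∂ₜ(½|v|²) + ∇·((½|v|² + p) v) = E'/2 ≤ 0` "in the distributional sense", i.e. `(v, p)` is a
globally dissipative Euler flow (`Torus.IsGloballyDissipativeEulerOn`).

What each approximant contributes is exactly its two **tested identities** against test
functions compactly supported in `(0,T)` — the momentum equation with pressure and Reynolds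
defect, and the relaxed local energy equality with defect density `D(t) = -E'(t)/2` and error
fluxes `κ_q`, `R_q v_q`, `φ_q` — so they are taken as hypotheses here (for smooth dissipative
Euler–Reynolds flows they are integration by parts); the content of this file is the uniform-limit
bookkeeping (`SpaceTimeUniformLimit`):

* (in `DistributionalEulerOfUniformLimit`) `Torus.momentum_of_unifLimit`,
  `Torus.isWeaklyDivFree_of_unifLimit` — the limit pair solves the pressure-explicit
  distributional momentum equation and is weakly incompressible;
* `Torus.localEnergyBalance_of_unifLimit` — the limit pair satisfies the tested local energy
  balance `∫∫ ½|u|²∂ₜψ + (½|u|² + P)⟪u,∇ψ⟫ = ∫₀ᵀ D(t) ∫ψ(t,·)`;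
* `Torus.isGloballyDissipativeEulerOn_of_unifLimit` — with `D ≥ 0` the limit is a globally
  dissipative Euler flow on `[0,T] × T^d`, with the balance above (feed it to
  `Torus.kineticEnergy_sub_eq_neg_setIntegral_of_localEnergyBalance`,
  `GloballyDissipativeEulerEnergy`, for the strict energy drop (Onsager) of Thm. 1.1).

## References

* C. De Lellis, H. Kwon, *On nonuniqueness of Hölder continuous globally dissipative Euler
  flows*, Anal. PDE 15 (2022) 2003–2059 = arXiv:2006.06482, Def. 2.1, §2.2, §2.3.
  [DelellisKwon2022]
* T. Buckmaster, C. De Lellis, L. Székelyhidi Jr., V. Vicol, CPAM 72 (2019), §2.2 (the same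
  limit step without the local energy inequality; tree: `Torus.isWeakEulerSolutionOn_of_unifLimit`).
-/

noncomputable section

open MeasureTheory Set Filter Function
open scoped InnerProductSpace RealInnerProductSpace ENNReal NNReal Topology

namespace Literature.Analysis.FluidPDE.Torus

variable {d : Type*} [Fintype d] [DecidableEq d]

/-- Continuity of the space–time lift of the energy-flux integrand
`½|w|² ∂ₜψ + (½|w|² + r) ⟪w, ∇ψ⟫` for fields `w, r` with continuous lifts and a scalar test `ψ`. [folklore] -/
theorem continuousOn_stLift_energyFluxIntegrand {T : ℝ} (hT : 0 < T)
    {ψ : ℝ → UnitAddTorus d → ℝ} (hψ : FunctionSpaces.Torus.IsSpaceTimeTestIoo T ψ)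
    {w : ℝ → UnitAddTorus d → EuclideanSpace ℝ d} {r : ℝ → UnitAddTorus d → ℝ}
    (hw : ContinuousOn (FunctionSpaces.Torus.stLift w) (Icc 0 T ×ˢ univ)) (hr : ContinuousOn (FunctionSpaces.Torus.stLift r) (Icc 0 T ×ˢ univ)) :
    ContinuousOn (FunctionSpaces.Torus.stLift fun t x => 2⁻¹ * ‖w t x‖ ^ 2 * FunctionSpaces.Torus.timeDeriv ψ t x +
      (2⁻¹ * ‖w t x‖ ^ 2 + r t x) * ⟪w t x, FunctionSpaces.Torus.gradient (ψ t) x⟫_ℝ) (Icc 0 T ×ˢ univ) := by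
  have hU : UniqueDiffOn ℝ (Icc 0 T) := uniqueDiffOn_Icc hT
  have hψI : FunctionSpaces.Torus.IsSmoothSpaceTimeOn (Icc 0 T) ψ := hψ.1.1.contDiffOn
  have hψ'c : ContinuousOn (FunctionSpaces.Torus.stLift (FunctionSpaces.Torus.timeDeriv ψ)) (Icc 0 T ×ˢ univ) :=
    hψ.1.timeDeriv.1.continuous.continuousOn
  have hgradc : ContinuousOn (FunctionSpaces.Torus.stLift fun t x => FunctionSpaces.Torus.gradient (ψ t) x) (Icc 0 T ×ˢ univ) :=
    (hψI.gradient hU).continuousOn_stLift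
  have he : ContinuousOn (FunctionSpaces.Torus.stLift fun t x => 2⁻¹ * ‖w t x‖ ^ 2) (Icc 0 T ×ˢ univ) :=
    FunctionSpaces.Torus.continuousOn_stLift_comp₂ hw hw (Φ := fun a _ => 2⁻¹ * ‖a‖ ^ 2)
      (continuous_const.mul ((continuous_norm.pow 2).comp continuous_fst))
  have hflux : ContinuousOn (FunctionSpaces.Torus.stLift fun t x => ⟪w t x, FunctionSpaces.Torus.gradient (ψ t) x⟫_ℝ) (Icc 0 T ×ˢ univ) :=
    FunctionSpaces.Torus.continuousOn_stLift_comp₂ hw hgradc (Φ := fun a b => ⟪a, b⟫_ℝ) continuous_inner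
  exact FunctionSpaces.Torus.continuousOn_stLift_comp₂
    (FunctionSpaces.Torus.continuousOn_stLift_comp₂ he hψ'c (Φ := fun a b => a * b) continuous_mul)
    (FunctionSpaces.Torus.continuousOn_stLift_comp₂ (FunctionSpaces.Torus.continuousOn_stLift_comp₂ he hr (Φ := fun a b => a + b)
      continuous_add) hflux (Φ := fun a b => a * b) continuous_mul)
    (Φ := fun a b => a + b) continuous_add

/-- **The relaxed local energy equality passes to uniform limits** (De Lellis–Kwon 2022, §2.2:
"the limit `(v,p)` ... satisfies the local energy equality in the distributional sense"). If
continuous fields `(v_q, p_q, R_q, κ_q, φ_q)` on `[0,T] × T^d` satisfy, for every smooth scalar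
test `ψ` compactly supported in `(0,T)`, the tested relaxed local energy equality of a dissipative
Euler–Reynolds flow with defect density `D(t)` (`= -E'(t)/2` for the energy loss `E` of Def. 2.1),
`∫∫ ½|v_q|²∂ₜψ + (½|v_q|² + p_q)⟪v_q,∇ψ⟫
   = ∫∫ κ_q ∂ₜψ + κ_q ⟪v_q,∇ψ⟫ + D ψ + ⟪R_q v_q, ∇ψ⟫ + ⟪φ_q, ∇ψ⟫`,
and `v_q → u`, `p_q → P` uniformly while `R_q, κ_q, φ_q → 0` uniformly, then
`∫∫ ½|u|²∂ₜψ + (½|u|² + P)⟪u,∇ψ⟫ = ∫₀ᵀ D(t) ∫ ψ(t,x) dx dt`. [cite: DelellisKwon2022, §2.2] -/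
theorem localEnergyBalance_of_unifLimit {T : ℝ} (hT : 0 < T)
    {v : ℕ → ℝ → UnitAddTorus d → EuclideanSpace ℝ d} {p : ℕ → ℝ → UnitAddTorus d → ℝ}
    {R : ℕ → ℝ → UnitAddTorus d → d → EuclideanSpace ℝ d} {κ : ℕ → ℝ → UnitAddTorus d → ℝ}
    {φ : ℕ → ℝ → UnitAddTorus d → EuclideanSpace ℝ d} {D : ℝ → ℝ}
    {u : ℝ → UnitAddTorus d → EuclideanSpace ℝ d} {P : ℝ → UnitAddTorus d → ℝ}
    (hvc : ∀ q, ContinuousOn (FunctionSpaces.Torus.stLift (v q)) (Icc 0 T ×ˢ univ))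
    (hpc : ∀ q, ContinuousOn (FunctionSpaces.Torus.stLift (p q)) (Icc 0 T ×ˢ univ))
    (hRc : ∀ q, ContinuousOn (FunctionSpaces.Torus.stLift (R q)) (Icc 0 T ×ˢ univ))
    (hκc : ∀ q, ContinuousOn (FunctionSpaces.Torus.stLift (κ q)) (Icc 0 T ×ˢ univ))
    (hφc : ∀ q, ContinuousOn (FunctionSpaces.Torus.stLift (φ q)) (Icc 0 T ×ˢ univ))
    (hD : ContinuousOn D (Icc 0 T))
    (hener : ∀ q, ∀ ψ : ℝ → UnitAddTorus d → ℝ, FunctionSpaces.Torus.IsSpaceTimeTestIoo T ψ →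
      ∫ t in Ioo 0 T, ∫ x, (2⁻¹ * ‖v q t x‖ ^ 2 * FunctionSpaces.Torus.timeDeriv ψ t x +
          (2⁻¹ * ‖v q t x‖ ^ 2 + p q t x) * ⟪v q t x, FunctionSpaces.Torus.gradient (ψ t) x⟫_ℝ) =
        ∫ t in Ioo 0 T, ∫ x, (κ q t x * FunctionSpaces.Torus.timeDeriv ψ t x + κ q t x * ⟪v q t x, FunctionSpaces.Torus.gradient (ψ t) x⟫_ℝ +
          D t * ψ t x + ⟪∑ j, v q t x j • R q t x j, FunctionSpaces.Torus.gradient (ψ t) x⟫_ℝ +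
          ⟪φ q t x, FunctionSpaces.Torus.gradient (ψ t) x⟫_ℝ))
    (hv : ∀ ε > (0 : ℝ), ∃ N : ℕ, ∀ q ≥ N, ∀ t ∈ Icc 0 T, ∀ x, ‖v q t x - u t x‖ ≤ ε)
    (hp : ∀ ε > (0 : ℝ), ∃ N : ℕ, ∀ q ≥ N, ∀ t ∈ Icc 0 T, ∀ x, ‖p q t x - P t x‖ ≤ ε)
    (hR : ∀ ε > (0 : ℝ), ∃ N : ℕ, ∀ q ≥ N, ∀ t ∈ Icc 0 T, ∀ x, ‖R q t x‖ ≤ ε)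
    (hκ : ∀ ε > (0 : ℝ), ∃ N : ℕ, ∀ q ≥ N, ∀ t ∈ Icc 0 T, ∀ x, ‖κ q t x‖ ≤ ε)
    (hφ : ∀ ε > (0 : ℝ), ∃ N : ℕ, ∀ q ≥ N, ∀ t ∈ Icc 0 T, ∀ x, ‖φ q t x‖ ≤ ε)
    {ψ : ℝ → UnitAddTorus d → ℝ} (hψ : FunctionSpaces.Torus.IsSpaceTimeTestIoo T ψ) :
    ∫ t in Ioo 0 T, ∫ x, (2⁻¹ * ‖u t x‖ ^ 2 * FunctionSpaces.Torus.timeDeriv ψ t x +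
        (2⁻¹ * ‖u t x‖ ^ 2 + P t x) * ⟪u t x, FunctionSpaces.Torus.gradient (ψ t) x⟫_ℝ) =
      ∫ t in Ioo 0 T, D t * ∫ x, ψ t x := by
  have hU : UniqueDiffOn ℝ (Icc 0 T) := uniqueDiffOn_Icc hT
  have huc : ContinuousOn (FunctionSpaces.Torus.stLift u) (Icc 0 T ×ˢ univ) := continuousOn_stLift_of_unifLimit hvc hv
  have hPc : ContinuousOn (FunctionSpaces.Torus.stLift P) (Icc 0 T ×ˢ univ) := continuousOn_stLift_of_unifLimit hpc hp
  obtain ⟨C, hC⟩ := FunctionSpaces.Torus.exists_norm_le_of_continuousOn_of_isCompact huc isCompact_Icc subset_rfl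
  have hC0 : 0 ≤ C := (norm_nonneg _).trans (hC 0 ⟨le_rfl, hT.le⟩ 0)
  obtain ⟨CP, hCP⟩ := FunctionSpaces.Torus.exists_norm_le_of_continuousOn_of_isCompact hPc isCompact_Icc subset_rfl
  -- test-function data
  have hψI : FunctionSpaces.Torus.IsSmoothSpaceTimeOn (Icc 0 T) ψ := hψ.1.1.contDiffOn
  have hψc : ContinuousOn (FunctionSpaces.Torus.stLift ψ) (Icc 0 T ×ˢ univ) := hψ.1.1.continuous.continuousOn
  have hψ'c : ContinuousOn (FunctionSpaces.Torus.stLift (FunctionSpaces.Torus.timeDeriv ψ)) (Icc 0 T ×ˢ univ) :=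
    hψ.1.timeDeriv.1.continuous.continuousOn
  have hgrad : FunctionSpaces.Torus.IsSmoothSpaceTimeOn (Icc 0 T) (fun t => FunctionSpaces.Torus.gradient (ψ t)) := hψI.gradient hU
  have hgradc : ContinuousOn (FunctionSpaces.Torus.stLift fun t x => FunctionSpaces.Torus.gradient (ψ t) x) (Icc 0 T ×ˢ univ) :=
    hgrad.continuousOn_stLift
  obtain ⟨K₀, hK₀⟩ := FunctionSpaces.Torus.exists_norm_le_of_continuousOn_of_isCompact hψc isCompact_Icc subset_rfl
  obtain ⟨K₁, hK₁⟩ := FunctionSpaces.Torus.exists_norm_le_of_continuousOn_of_isCompact hψ'c isCompact_Icc subset_rfl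
  obtain ⟨K₂, hK₂⟩ := hgrad.exists_norm_le_of_isCompact isCompact_Icc subset_rfl
  -- uniform convergence of the left integrand
  have he : ∀ ε > (0 : ℝ), ∃ N : ℕ, ∀ q ≥ N, ∀ t ∈ Icc 0 T, ∀ x,
      ‖2⁻¹ * ‖v q t x‖ ^ 2 - 2⁻¹ * ‖u t x‖ ^ 2‖ ≤ ε :=
    unifTo_mul (unifTo_const fun (_ : ℝ) (_ : UnitAddTorus d) => (2⁻¹ : ℝ)) (unifTo_norm_sq hv hC)
      (C := 2⁻¹) (fun _ _ _ => by simp) (C' := C ^ 2) (fun t ht x => by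
        rw [Real.norm_eq_abs, abs_of_nonneg (sq_nonneg _)]
        exact pow_le_pow_left₀ (norm_nonneg _) (hC t ht x) 2)
  have heb : ∀ t ∈ Icc 0 T, ∀ x, ‖2⁻¹ * ‖u t x‖ ^ 2‖ ≤ 2⁻¹ * C ^ 2 := fun t ht x => by
    rw [norm_mul, Real.norm_eq_abs, Real.norm_eq_abs, abs_of_nonneg (by norm_num : (0:ℝ) ≤ 2⁻¹),
      abs_of_nonneg (sq_nonneg _)]
    exact mul_le_mul_of_nonneg_left (pow_le_pow_left₀ (norm_nonneg _) (hC t ht x) 2) (by norm_num)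
  have hflux := unifTo_inner hv (unifTo_const fun t x => FunctionSpaces.Torus.gradient (ψ t) x) hC hK₂
  have hfluxb : ∀ t ∈ Icc 0 T, ∀ x, ‖⟪u t x, FunctionSpaces.Torus.gradient (ψ t) x⟫_ℝ‖ ≤ C * K₂ := fun t ht x =>
    (norm_inner_le_norm _ _).trans (mul_le_mul (hC t ht x) (hK₂ t ht x) (norm_nonneg _) hC0)
  have hg := unifTo_add (unifTo_mul he (unifTo_const (FunctionSpaces.Torus.timeDeriv ψ)) heb hK₁)
    (unifTo_mul (unifTo_add he hp) hflux (C := 2⁻¹ * C ^ 2 + CP)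
      (fun t ht x => (norm_add_le _ _).trans (add_le_add (heb t ht x) (hCP t ht x))) hfluxb)
  -- the right integrand tends to `D ψ` uniformly
  obtain ⟨Nv, hNv⟩ := exists_bound_of_unifTo hv hC
  have hRv : ∀ ε > (0 : ℝ), ∃ N : ℕ, ∀ q ≥ N, ∀ t ∈ Icc 0 T, ∀ x,
      ‖∑ j, v q t x j • R q t x j‖ ≤ ε := by
    intro ε hε
    have hL : 0 < (Fintype.card d : ℝ) * (C + 1) + 1 := by positivity
    obtain ⟨N, hN⟩ := hR (ε / ((Fintype.card d : ℝ) * (C + 1) + 1)) (div_pos hε hL)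
    refine ⟨max N Nv, fun q hq t ht x => ?_⟩
    have h1 := hN q ((le_max_left _ _).trans hq) t ht x
    have h2 := hNv q ((le_max_right _ _).trans hq) t ht x
    calc ‖∑ j, v q t x j • R q t x j‖ ≤ ∑ j, ‖v q t x j • R q t x j‖ := norm_sum_le _ _
      _ ≤ ∑ _j : d, (C + 1) * (ε / ((Fintype.card d : ℝ) * (C + 1) + 1)) :=
          Finset.sum_le_sum fun j _ => by
            rw [norm_smul]
            exact mul_le_mul ((PiLp.norm_apply_le (v q t x) j).trans h2)
              ((norm_le_pi_norm (R q t x) j).trans h1) (norm_nonneg _) (by linarith)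
      _ = (Fintype.card d : ℝ) * (C + 1) * (ε / ((Fintype.card d : ℝ) * (C + 1) + 1)) := by
          simp [mul_assoc]
      _ ≤ ε := by
          rw [mul_div_assoc', div_le_iff₀ hL]
          nlinarith [mul_nonneg (Nat.cast_nonneg (Fintype.card d) : (0:ℝ) ≤ _) (by linarith : (0:ℝ) ≤ C + 1)]
  have hfluxq : ∀ q ≥ Nv, ∀ t ∈ Icc 0 T, ∀ x, ‖⟪v q t x, FunctionSpaces.Torus.gradient (ψ t) x⟫_ℝ‖ ≤ (C + 1) * K₂ :=
    fun q hq t ht x => (norm_inner_le_norm _ _).trans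
      (mul_le_mul (hNv q hq t ht x) (hK₂ t ht x) (norm_nonneg _) (by linarith))
  have h1 := unifTo_bilin_zero (S := Icc 0 T) (ContinuousLinearMap.mul ℝ ℝ) hκ (N₀ := 0)
    (w' := fun (_ : ℕ) => FunctionSpaces.Torus.timeDeriv ψ) (fun q _ t ht x => hK₁ t ht x)
  have h2 := unifTo_bilin_zero (S := Icc 0 T) (ContinuousLinearMap.mul ℝ ℝ) hκ hfluxq
  have h4 := unifTo_bilin_zero (S := Icc 0 T) (innerSL ℝ) hRv (N₀ := 0)
    (w' := fun (_ : ℕ) t x => FunctionSpaces.Torus.gradient (ψ t) x) (fun q _ t ht x => hK₂ t ht x)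
  have h5 := unifTo_bilin_zero (S := Icc 0 T) (innerSL ℝ) hφ (N₀ := 0)
    (w' := fun (_ : ℕ) t x => FunctionSpaces.Torus.gradient (ψ t) x) (fun q _ t ht x => hK₂ t ht x)
  simp only [ContinuousLinearMap.mul_apply'] at h1 h2
  have hh₀ := unifTo_add (unifTo_add (unifTo_add (unifTo_add (unifTo_zero_of_norm_le h1)
    (unifTo_zero_of_norm_le h2)) (unifTo_const (S := Icc 0 T) fun t x => D t * ψ t x))
    (unifTo_zero_of_norm_le h4)) (unifTo_zero_of_norm_le h5)
  have hh := unifTo_congr hh₀ (fun q t _ x => rfl) (u' := fun t x => D t * ψ t x)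
    (fun t _ x => by simp)
  -- continuity of all lifts
  have hgc : ∀ q, ContinuousOn (FunctionSpaces.Torus.stLift fun t x => 2⁻¹ * ‖v q t x‖ ^ 2 * FunctionSpaces.Torus.timeDeriv ψ t x +
      (2⁻¹ * ‖v q t x‖ ^ 2 + p q t x) * ⟪v q t x, FunctionSpaces.Torus.gradient (ψ t) x⟫_ℝ) (Icc 0 T ×ˢ univ) := fun q =>
    continuousOn_stLift_energyFluxIntegrand hT hψ (hvc q) (hpc q)
  have hg₀c := continuousOn_stLift_energyFluxIntegrand hT hψ huc hPc
  have hDc : ContinuousOn (FunctionSpaces.Torus.stLift fun t x => D t * ψ t x) (Icc 0 T ×ˢ univ) :=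
    FunctionSpaces.Torus.continuousOn_stLift_comp₂ (continuousOn_stLift_of_time hD) hψc (Φ := fun a b => a * b)
      continuous_mul
  have hhc : ∀ q, ContinuousOn (FunctionSpaces.Torus.stLift fun t x => κ q t x * FunctionSpaces.Torus.timeDeriv ψ t x +
      κ q t x * ⟪v q t x, FunctionSpaces.Torus.gradient (ψ t) x⟫_ℝ + D t * ψ t x +
      ⟪∑ j, v q t x j • R q t x j, FunctionSpaces.Torus.gradient (ψ t) x⟫_ℝ + ⟪φ q t x, FunctionSpaces.Torus.gradient (ψ t) x⟫_ℝ)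
      (Icc 0 T ×ˢ univ) := by
    intro q
    have hRv' : ContinuousOn (FunctionSpaces.Torus.stLift fun t x => ∑ j, v q t x j • R q t x j) (Icc 0 T ×ˢ univ) :=
      continuousOn_stLift_sum Finset.univ fun j _ =>
        FunctionSpaces.Torus.continuousOn_stLift_comp₂ (hvc q) (continuousOn_stLift_column (hRc q) j)
          (Φ := fun a b => a j • b)
          (((EuclideanSpace.proj j).continuous.comp continuous_fst).smul continuous_snd)
    refine FunctionSpaces.Torus.continuousOn_stLift_comp₂ (FunctionSpaces.Torus.continuousOn_stLift_comp₂ (FunctionSpaces.Torus.continuousOn_stLift_comp₂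
      (FunctionSpaces.Torus.continuousOn_stLift_comp₂ ?_ ?_ (Φ := fun a b => a + b) continuous_add) hDc
      (Φ := fun a b => a + b) continuous_add) ?_ (Φ := fun a b => a + b) continuous_add) ?_
      (Φ := fun a b => a + b) continuous_add
    · exact FunctionSpaces.Torus.continuousOn_stLift_comp₂ (hκc q) hψ'c (Φ := fun a b => a * b) continuous_mul
    · exact FunctionSpaces.Torus.continuousOn_stLift_comp₂ (hκc q) (FunctionSpaces.Torus.continuousOn_stLift_comp₂ (hvc q) hgradc
        (Φ := fun a b => ⟪a, b⟫_ℝ) continuous_inner) (Φ := fun a b => a * b) continuous_mul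
    · exact FunctionSpaces.Torus.continuousOn_stLift_comp₂ hRv' hgradc (Φ := fun a b => ⟪a, b⟫_ℝ) continuous_inner
    · exact FunctionSpaces.Torus.continuousOn_stLift_comp₂ (hφc q) hgradc (Φ := fun a b => ⟪a, b⟫_ℝ) continuous_inner
  -- pass to the limit
  have hlim := integral_integral_eq_of_unifTo hT.le hgc hg₀c hhc hDc hg hh (fun q => hener q ψ hψ)
  rw [hlim]
  exact setIntegral_congr_fun measurableSet_Ioo fun t _ => MeasureTheory.integral_const_mul _ _

/-- **Uniform limits of dissipative Euler–Reynolds-type approximations with vanishing errors are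
globally dissipative Euler flows** (De Lellis–Kwon 2022, §2.2–2.3, the passage to the limit in
the proof of Thm. 1.1; Def. 2.1 for the system). Let continuous fields
`(v_q, p_q, R_q, κ_q, φ_q)` on `[0,T] × T^d`, `0 < T`, have weakly divergence-free velocities and
satisfy against all test functions compactly supported in `(0,T)` the tested momentum identity
with pressure and Reynolds defect and the tested relaxed local energy equality with a continuous
defect density `D(t) ≥ 0` (for the flows of Def. 2.1, `D = -E'/2` with `E' ≤ 0`). If
`v_q → u`, `p_q → P` uniformly and `R_q, κ_q, φ_q → 0` uniformly, then `(u, P)` is a globally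
dissipative Euler flow on `[0,T] × T^d` (`Torus.IsGloballyDissipativeEulerOn T u P`: a
distributional Euler solution of class `L³ × L^{3/2}` with the local energy inequality), and its
local energy balance is `∫∫ ½|u|²∂ₜψ + (½|u|² + P)⟪u,∇ψ⟫ = ∫₀ᵀ D(t) ∫ψ(t,·) dt` for every
scalar test `ψ`. [cite: DelellisKwon2022, §2.2–2.3] -/
theorem isGloballyDissipativeEulerOn_of_unifLimit {T : ℝ} (hT : 0 < T)
    {v : ℕ → ℝ → UnitAddTorus d → EuclideanSpace ℝ d} {p : ℕ → ℝ → UnitAddTorus d → ℝ}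
    {R : ℕ → ℝ → UnitAddTorus d → d → EuclideanSpace ℝ d} {κ : ℕ → ℝ → UnitAddTorus d → ℝ}
    {φ : ℕ → ℝ → UnitAddTorus d → EuclideanSpace ℝ d} {D : ℝ → ℝ}
    {u : ℝ → UnitAddTorus d → EuclideanSpace ℝ d} {P : ℝ → UnitAddTorus d → ℝ}
    (hvc : ∀ q, ContinuousOn (FunctionSpaces.Torus.stLift (v q)) (Icc 0 T ×ˢ univ))
    (hpc : ∀ q, ContinuousOn (FunctionSpaces.Torus.stLift (p q)) (Icc 0 T ×ˢ univ))
    (hRc : ∀ q, ContinuousOn (FunctionSpaces.Torus.stLift (R q)) (Icc 0 T ×ˢ univ))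
    (hκc : ∀ q, ContinuousOn (FunctionSpaces.Torus.stLift (κ q)) (Icc 0 T ×ˢ univ))
    (hφc : ∀ q, ContinuousOn (FunctionSpaces.Torus.stLift (φ q)) (Icc 0 T ×ˢ univ))
    (hD : ContinuousOn D (Icc 0 T)) (hD0 : ∀ t ∈ Icc 0 T, 0 ≤ D t)
    (hdiv : ∀ q, ∀ t ∈ Icc 0 T, FunctionSpaces.Torus.IsWeaklyDivFree (v q t))
    (hmom : ∀ q, ∀ ψ : ℝ → UnitAddTorus d → EuclideanSpace ℝ d, FunctionSpaces.Torus.IsSpaceTimeTestIoo T ψ →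
      ∫ t in Ioo 0 T, ∫ x, (⟪v q t x, FunctionSpaces.Torus.timeDeriv ψ t x⟫_ℝ +
          ⟪v q t x, FunctionSpaces.Torus.convect (v q t) (ψ t) x⟫_ℝ + p q t x * FunctionSpaces.Torus.divergence (ψ t) x) =
        ∫ t in Ioo 0 T, ∫ x, ∑ j, ⟪R q t x j, FunctionSpaces.Torus.partialDeriv j (ψ t) x⟫_ℝ)
    (hener : ∀ q, ∀ ψ : ℝ → UnitAddTorus d → ℝ, FunctionSpaces.Torus.IsSpaceTimeTestIoo T ψ →
      ∫ t in Ioo 0 T, ∫ x, (2⁻¹ * ‖v q t x‖ ^ 2 * FunctionSpaces.Torus.timeDeriv ψ t x +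
          (2⁻¹ * ‖v q t x‖ ^ 2 + p q t x) * ⟪v q t x, FunctionSpaces.Torus.gradient (ψ t) x⟫_ℝ) =
        ∫ t in Ioo 0 T, ∫ x, (κ q t x * FunctionSpaces.Torus.timeDeriv ψ t x + κ q t x * ⟪v q t x, FunctionSpaces.Torus.gradient (ψ t) x⟫_ℝ +
          D t * ψ t x + ⟪∑ j, v q t x j • R q t x j, FunctionSpaces.Torus.gradient (ψ t) x⟫_ℝ +
          ⟪φ q t x, FunctionSpaces.Torus.gradient (ψ t) x⟫_ℝ))
    (hv : ∀ ε > (0 : ℝ), ∃ N : ℕ, ∀ q ≥ N, ∀ t ∈ Icc 0 T, ∀ x, ‖v q t x - u t x‖ ≤ ε)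
    (hp : ∀ ε > (0 : ℝ), ∃ N : ℕ, ∀ q ≥ N, ∀ t ∈ Icc 0 T, ∀ x, ‖p q t x - P t x‖ ≤ ε)
    (hR : ∀ ε > (0 : ℝ), ∃ N : ℕ, ∀ q ≥ N, ∀ t ∈ Icc 0 T, ∀ x, ‖R q t x‖ ≤ ε)
    (hκ : ∀ ε > (0 : ℝ), ∃ N : ℕ, ∀ q ≥ N, ∀ t ∈ Icc 0 T, ∀ x, ‖κ q t x‖ ≤ ε)
    (hφ : ∀ ε > (0 : ℝ), ∃ N : ℕ, ∀ q ≥ N, ∀ t ∈ Icc 0 T, ∀ x, ‖φ q t x‖ ≤ ε) :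
    IsGloballyDissipativeEulerOn T u P ∧
      ∀ ψ : ℝ → UnitAddTorus d → ℝ, FunctionSpaces.Torus.IsSpaceTimeTestIoo T ψ →
        ∫ t in Ioo 0 T, ∫ x, (2⁻¹ * ‖u t x‖ ^ 2 * FunctionSpaces.Torus.timeDeriv ψ t x +
            (2⁻¹ * ‖u t x‖ ^ 2 + P t x) * ⟪u t x, FunctionSpaces.Torus.gradient (ψ t) x⟫_ℝ) =
          ∫ t in Ioo 0 T, D t * ∫ x, ψ t x := by
  have huc : ContinuousOn (FunctionSpaces.Torus.stLift u) (Icc 0 T ×ˢ univ) := continuousOn_stLift_of_unifLimit hvc hv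
  have hPc : ContinuousOn (FunctionSpaces.Torus.stLift P) (Icc 0 T ×ˢ univ) := continuousOn_stLift_of_unifLimit hpc hp
  obtain ⟨C, hC⟩ := FunctionSpaces.Torus.exists_norm_le_of_continuousOn_of_isCompact huc isCompact_Icc subset_rfl
  obtain ⟨CP, hCP⟩ := FunctionSpaces.Torus.exists_norm_le_of_continuousOn_of_isCompact hPc isCompact_Icc subset_rfl
  have hbal : ∀ ψ : ℝ → UnitAddTorus d → ℝ, FunctionSpaces.Torus.IsSpaceTimeTestIoo T ψ →
      ∫ t in Ioo 0 T, ∫ x, (2⁻¹ * ‖u t x‖ ^ 2 * FunctionSpaces.Torus.timeDeriv ψ t x +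
          (2⁻¹ * ‖u t x‖ ^ 2 + P t x) * ⟪u t x, FunctionSpaces.Torus.gradient (ψ t) x⟫_ℝ) =
        ∫ t in Ioo 0 T, D t * ∫ x, ψ t x := fun ψ hψ =>
    localEnergyBalance_of_unifLimit hT hvc hpc hRc hκc hφc hD hener hv hp hR hκ hφ hψ
  have hub : ∀ t ∈ Ioo 0 T, ∀ x, ‖u t x‖ₑ ≤ ENNReal.ofReal C := fun t ht x => by
    rw [← ofReal_norm]; exact ENNReal.ofReal_le_ofReal (hC t (Ioo_subset_Icc_self ht) x)
  have hPb : ∀ t ∈ Ioo 0 T, ∀ x, ‖P t x‖ₑ ≤ ENNReal.ofReal CP := fun t ht x => by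
    rw [← ofReal_norm]; exact ENNReal.ofReal_le_ofReal (hCP t (Ioo_subset_Icc_self ht) x)
  refine ⟨⟨⟨?_, ?_, ?_, ?_, ?_, ?_⟩, ?_, ?_, ?_⟩, hbal⟩
  -- measurability of `u`
  · exact (huc.mono (prod_mono Ioo_subset_Icc_self subset_rfl)).aestronglyMeasurable
      (measurableSet_Ioo.prod MeasurableSet.univ)
  -- `u ∈ L²`
  · exact lintegral_lintegral_lt_top_of_le (ENNReal.pow_ne_top ENNReal.ofReal_ne_top)
      fun t ht x => pow_le_pow_left' (hub t ht x) 2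
  -- measurability of `P`
  · exact (hPc.mono (prod_mono Ioo_subset_Icc_self subset_rfl)).aestronglyMeasurable
      (measurableSet_Ioo.prod MeasurableSet.univ)
  -- `P ∈ L¹`
  · exact lintegral_lintegral_lt_top_of_le ENNReal.ofReal_ne_top hPb
  -- weak incompressibility
  · exact (ae_restrict_iff' measurableSet_Ioo).2 (ae_of_all _ fun t ht =>
      isWeaklyDivFree_of_unifLimit hvc hdiv hv (Ioo_subset_Icc_self ht))
  -- momentum equation
  · intro ψ hψ
    have h := momentum_of_unifLimit hT hvc hpc hRc hmom hv hp hR hψ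
    simpa only [zero_mul, add_zero, Pi.zero_apply, inner_zero_left] using h
  -- `u ∈ L³`
  · exact lintegral_lintegral_lt_top_of_le (ENNReal.pow_ne_top ENNReal.ofReal_ne_top)
      fun t ht x => pow_le_pow_left' (hub t ht x) 3
  -- `P ∈ L^{3/2}`
  · exact lintegral_lintegral_lt_top_of_le
      (ENNReal.rpow_ne_top_of_nonneg (by norm_num) ENNReal.ofReal_ne_top)
      fun t ht x => ENNReal.rpow_le_rpow (hPb t ht x) (by norm_num)
  -- local energy inequality
  · intro ψ hψ hψ0
    rw [hbal ψ hψ]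
    exact setIntegral_nonneg measurableSet_Ioo fun t ht =>
      mul_nonneg (hD0 t (Ioo_subset_Icc_self ht)) (integral_nonneg (hψ0 t))

end Literature.Analysis.FluidPDE.Torus
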